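/-
Copyright (c) 2026 the pub-hodgecm-mathlib formalisation cell (harness21).  Prover seat hodgecm-mathlib-F0P3a-p01 (g21), 2026-09-02.
-/
import Literature.NumberTheory.LocalFields.SLnCompactSubgroups        -- ★ p850730: `mem_closure_isCompact_of_det_mem_integer` (the `⊇` half)
import HarnessLib

/-!
# Over a non-archimedean local field, the subgroup of `GL_n(F)` generated by the compact subgroups is `{g | v(det g) = 1}`

Topic `NumberTheory/LocalFields`; namespace `Literature.NumberTheory.LocalFields`.  THEOREMS ONLY (no `def`, no instance, no notation, no named fact,
no `sorry`).  EDITION 2 of the compact-subgroup layer ★ p850404 (`GLnCompactSubgroupsGenerate`: `GL_n(F) = ⟨compact subgroups, one-slot diagonals⟩`)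
∕ ★ p850730 (`SLnCompactSubgroups`: `det g ∈ 𝒪_Fˣ ⇒ g ∈ ⟨compact subgroups⟩`), supplying the reverse inclusion that ★ p850730's module docstring
records as «NOT here»:

* §1 **`valuation_det_le_one_of_mem_of_isCompact`** ∕ **`valuation_det_eq_one_of_mem_of_isCompact`** — every element of a COMPACT subgroup
  `K ≤ GL_n(F)` has `v(det k) = 1` (extreme value of the continuous map `k ↦ v(det k)` on `K` for the `WithZeroTopology` of the value group, and
  `v(det (k₀ k₀)) = M² ≤ M` kills `M > 1`; the inverse gives `≥ 1`) — «continuous characters of a compact group into the discrete value group are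
  trivial», i.e. `𝒪_Fˣ` is the maximal compact subgroup of `Fˣ` seen through `det`;
* §2 **`valuation_det_eq_one_of_mem_closure_isCompact`** (closure induction) and the characterisation
  **`mem_closure_isCompact_iff_valuation_det_eq_one`** ∕ **`mem_closure_isCompact_iff_det_mem_integer`** ∕
  **`coe_closure_isCompact_eq_setOf_valuation_det_eq_one`**:
  `Subgroup.closure (⋃ K ∈ {K : Subgroup (GL (Fin n) F) | IsCompact ↑K}, ↑K) = {g | v(det g) = 1} = {g | det g, (det g)⁻¹ ∈ 𝒪_F}`
  (the compact-subgroup union written EXACTLY as in ★ p850404 ∕ ★ p850730 ∕ the `hg`∕`hgen` binders of ★ p850252);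
* §3 consequences: the generated subgroup is open and closed (it contains the compact open `GL_n(𝒪_F)`, ★ `isOpen_glInt`), it is proper as soon as
  `n ≥ 1` (**`closure_isCompact_ne_top`**: `diag(a, 1, …, 1) ∉` it for `v(a) ≠ 1`, and such `a` exist since the valuation is nontrivial), and the
  one-slot diagonal `glDiagonal n F (update 1 i a)` of ★ p850404's generating set lies in it iff `v(a) = 1`
  (**`glDiagonal_update_mem_closure_isCompact_iff`**) — so none of ★ p850404's extra generators is redundant modulo compact subgroups unless
  `a` is a unit.

Cell `pub/hodgecm-mathlib`, h413 = `stmt-HodgeConjecture-24833` (consumer class: split-place isotypy ∕ strong-approximation words — the subgroup on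
which «every compact subgroup acts through `χ`» arguments (★ p850252) are exhaustive is exactly `{v ∘ det = 1}`).  HONEST LABEL: count-neutral;
HC_CM is proved only modulo the printed citations of that programme until its rung 0 closes.

## References
* [PlatonovRapinchuk1994] V. Platonov, A. Rapinchuk, *Algebraic Groups and Number Theory* (1994), §3.3 (maximal compact subgroups of `GL_n` over a
  local field; `GL_n(𝒪)` and the subgroup `{g | det g ∈ 𝒪ˣ}` generated by its conjugates).
* [Serre1980Trees] J.-P. Serre, *Trees* (1980), Ch. II §1.2–§1.4 (`SL_2`, `GL_2` over a local field: the subgroup generated by the vertex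
  stabilisers is the kernel of `v ∘ det`).
* [Bump1997] D. Bump, *Automorphic Forms and Representations* (1997), §4.5, Exercise 4.5.1 (`GL(n, 𝔬)` is a maximal compact subgroup).
-/

set_option autoImplicit false

open Matrix ValuativeRel Topology
open scoped MatrixGroups
open Literature.NumberTheory.Automorphic

namespace Literature.NumberTheory.LocalFields

universe u

variable {F : Type u} [Field F] [ValuativeRel F] [TopologicalSpace F] [IsNonarchimedeanLocalField F]

/-! ## §1 Compact subgroups of `GL_n(F)` have unit determinant -/

open WithZeroTopology in
/-- **Extreme value step for `det`.**  On a compact subset `s ∋ k₁` of `GL_n(F)` the valuation of the determinant attains a maximum (the map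
`k ↦ v(det k)` is continuous for the `WithZeroTopology` on the value group, which is order-closed). [cite: Bump1997, §4.5 Exercise 4.5.1] -/
theorem exists_forall_valuation_det_le {n : ℕ} {s : Set (GL (Fin n) F)} (hs : IsCompact s) {k₁ : GL (Fin n) F} (hk₁ : k₁ ∈ s) :
    ∃ k₀ ∈ s, ∀ k ∈ s, valuation F (k : Matrix (Fin n) (Fin n) F).det ≤ valuation F (k₀ : Matrix (Fin n) (Fin n) F).det := by
  have hcont : Continuous fun k : GL (Fin n) F => valuation F (k : Matrix (Fin n) (Fin n) F).det :=
    IsValuativeTopology.continuous_valuation.comp (Units.continuous_val.matrix_det)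
  obtain ⟨k₀, hk₀, hmax⟩ := hs.exists_isMaxOn ⟨k₁, hk₁⟩ hcont.continuousOn
  exact ⟨k₀, hk₀, fun k hk => (isMaxOn_iff.mp hmax) k hk⟩

/-- **`v(det k) ≤ 1` on a compact subgroup.**  If `M = v(det k₀)` is the maximal determinant valuation on the compact subgroup `K` and `M > 1`,
then `k₀ k₀ ∈ K` has `v(det (k₀ k₀)) = M · M > M`, absurd. [cite: PlatonovRapinchuk1994, §3.3] [cite: Bump1997, §4.5 Exercise 4.5.1] -/
theorem valuation_det_le_one_of_mem_of_isCompact {n : ℕ} (K : Subgroup (GL (Fin n) F)) (hK : IsCompact (K : Set (GL (Fin n) F)))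
    {k : GL (Fin n) F} (hk : k ∈ K) : valuation F (k : Matrix (Fin n) (Fin n) F).det ≤ 1 := by
  by_contra! h1
  obtain ⟨k₀, hk₀, hmax⟩ := exists_forall_valuation_det_le (s := (K : Set (GL (Fin n) F))) hK hk
  generalize hM : valuation F (k₀ : Matrix (Fin n) (Fin n) F).det = M at hmax
  have h1M : 1 < M := h1.trans_le (hmax k hk)
  have hMM : M < M * M := by
    simpa only [one_mul] using mul_lt_mul_of_pos_right h1M (zero_lt_one.trans h1M)
  have hsq : valuation F ((k₀ * k₀ : GL (Fin n) F) : Matrix (Fin n) (Fin n) F).det = M * M := by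
    rw [Units.val_mul, Matrix.det_mul, map_mul, hM]
  have hle : M * M ≤ M := by
    have h := hmax (k₀ * k₀) (K.mul_mem hk₀ hk₀)
    rwa [hsq] at h
  exact absurd hMM (not_lt.mpr hle)

/-- **Compact subgroups of `GL_n(F)` have unit determinant**: `v(det k) = 1` for every `k` in a compact subgroup `K` (`≤ 1` for `k` and for
`k⁻¹ ∈ K`, whose determinant is `(det k)⁻¹`).  Equivalently: the continuous character `v ∘ det` of the compact group `K` into the (discrete,
torsion-free) value group is trivial — «`𝒪_Fˣ` is the maximal compact subgroup of `Fˣ`». [cite: PlatonovRapinchuk1994, §3.3] [cite: Serre1980Trees, Ch. II §1.2] -/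
theorem valuation_det_eq_one_of_mem_of_isCompact {n : ℕ} (K : Subgroup (GL (Fin n) F)) (hK : IsCompact (K : Set (GL (Fin n) F)))
    {k : GL (Fin n) F} (hk : k ∈ K) : valuation F (k : Matrix (Fin n) (Fin n) F).det = 1 := by
  refine le_antisymm (valuation_det_le_one_of_mem_of_isCompact K hK hk) ?_
  have hinv := valuation_det_le_one_of_mem_of_isCompact K hK (K.inv_mem hk)
  rw [Matrix.coe_units_inv, Matrix.det_nonsing_inv, Ring.inverse_eq_inv', map_inv₀] at hinv
  have h0 : valuation F (k : Matrix (Fin n) (Fin n) F).det ≠ 0 :=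
    (Valuation.ne_zero_iff _).2 (Matrix.GeneralLinearGroup.det_ne_zero k)
  exact (inv_le_one₀ (zero_lt_iff.2 h0)).1 hinv

/-! ## §2 The subgroup generated by the compact subgroups is `{g | v(det g) = 1}` -/

/-- **`⟨compact subgroups⟩ ≤ {v ∘ det = 1}`** (closure induction: `v ∘ det` is multiplicative, trivial on every compact subgroup by §1). [cite: Serre1980Trees, Ch. II §1.2–§1.4] [cite: PlatonovRapinchuk1994, §3.3] -/
theorem valuation_det_eq_one_of_mem_closure_isCompact {n : ℕ} {g : GL (Fin n) F}
    (hg : g ∈ Subgroup.closure (⋃ K ∈ {K : Subgroup (GL (Fin n) F) | IsCompact (K : Set (GL (Fin n) F))}, (K : Set (GL (Fin n) F)))) :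
    valuation F (g : Matrix (Fin n) (Fin n) F).det = 1 := by
  induction hg using Subgroup.closure_induction with
  | mem x hx =>
    obtain ⟨K, hK, hxK⟩ := Set.mem_iUnion₂.1 hx
    exact valuation_det_eq_one_of_mem_of_isCompact K hK hxK
  | one => rw [Units.val_one, Matrix.det_one, map_one]
  | mul x y _ _ hx hy => rw [Units.val_mul, Matrix.det_mul, map_mul, hx, hy, mul_one]
  | inv x _ hx => rw [Matrix.coe_units_inv, Matrix.det_nonsing_inv, Ring.inverse_eq_inv', map_inv₀, hx, inv_one]

/-- **Characterisation**: `g ∈ ⟨compact subgroups of GL_n(F)⟩ ↔ v(det g) = 1` (`→` §2; `←` ★ `mem_closure_isCompact_of_det_mem_integer`, p850730: `g = (g d⁻¹) · d`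
with `d = diag(det g, 1, …, 1) ∈ GL_n(𝒪_F)` and `g d⁻¹ ∈ SL_n(F) = ⟨transvections⟩`, each transvection in a compact open subgroup). [cite: PlatonovRapinchuk1994, §3.3] [cite: Serre1980Trees, Ch. II §1.4] -/
theorem mem_closure_isCompact_iff_valuation_det_eq_one {n : ℕ} (g : GL (Fin n) F) :
    g ∈ Subgroup.closure (⋃ K ∈ {K : Subgroup (GL (Fin n) F) | IsCompact (K : Set (GL (Fin n) F))}, (K : Set (GL (Fin n) F))) ↔
      valuation F (g : Matrix (Fin n) (Fin n) F).det = 1 := by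
  refine ⟨valuation_det_eq_one_of_mem_closure_isCompact, fun h => mem_closure_isCompact_of_det_mem_integer n g ?_ ?_⟩
  · exact (Valuation.mem_integer_iff _ _).2 h.le
  · refine (Valuation.mem_integer_iff _ _).2 ?_
    rw [map_inv₀, h, inv_one]

/-- The same characterisation in the `𝒪_F`-currency of ★ p850730: `g ∈ ⟨compact subgroups⟩ ↔ det g ∈ 𝒪_F ∧ (det g)⁻¹ ∈ 𝒪_F` (i.e. `det g ∈ 𝒪_Fˣ`).
[cite: PlatonovRapinchuk1994, §3.3] -/
theorem mem_closure_isCompact_iff_det_mem_integer {n : ℕ} (g : GL (Fin n) F) :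
    g ∈ Subgroup.closure (⋃ K ∈ {K : Subgroup (GL (Fin n) F) | IsCompact (K : Set (GL (Fin n) F))}, (K : Set (GL (Fin n) F))) ↔
      (g : Matrix (Fin n) (Fin n) F).det ∈ 𝒪[F] ∧ ((g : Matrix (Fin n) (Fin n) F).det)⁻¹ ∈ 𝒪[F] := by
  refine ⟨fun h => ?_, fun h => mem_closure_isCompact_of_det_mem_integer n g h.1 h.2⟩
  have h1 := valuation_det_eq_one_of_mem_closure_isCompact h
  refine ⟨(Valuation.mem_integer_iff _ _).2 h1.le, (Valuation.mem_integer_iff _ _).2 ?_⟩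
  rw [map_inv₀, h1, inv_one]

/-- **Set-level identity**: `↑⟨compact subgroups of GL_n(F)⟩ = {g | v(det g) = 1}` — the kernel of `v ∘ det : GL_n(F) → Γ`. [cite: Serre1980Trees, Ch. II §1.2–§1.4] [cite: PlatonovRapinchuk1994, §3.3] -/
theorem coe_closure_isCompact_eq_setOf_valuation_det_eq_one (n : ℕ) :
    (Subgroup.closure (⋃ K ∈ {K : Subgroup (GL (Fin n) F) | IsCompact (K : Set (GL (Fin n) F))}, (K : Set (GL (Fin n) F))) :
        Set (GL (Fin n) F)) = {g : GL (Fin n) F | valuation F (g : Matrix (Fin n) (Fin n) F).det = 1} :=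
  Set.ext fun g => mem_closure_isCompact_iff_valuation_det_eq_one (F := F) g

/-! ## §3 Consequences: open, closed, proper; which one-slot diagonals it contains -/

/-- `⟨compact subgroups⟩` is OPEN in `GL_n(F)` (it contains the compact open `GL_n(𝒪_F)`, ★ `isOpen_glInt`). [cite: PlatonovRapinchuk1994, §3.3] -/
theorem isOpen_closure_isCompact (n : ℕ) :
    IsOpen (Subgroup.closure (⋃ K ∈ {K : Subgroup (GL (Fin n) F) | IsCompact (K : Set (GL (Fin n) F))}, (K : Set (GL (Fin n) F))) :
      Set (GL (Fin n) F)) := by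
  refine Subgroup.isOpen_mono (H₁ := glInt n F) ?_ (isOpen_glInt n F)
  exact fun g hg => Subgroup.subset_closure (Set.mem_iUnion₂.2 ⟨glInt n F, isCompact_glInt n F, hg⟩)

/-- `⟨compact subgroups⟩` is CLOSED in `GL_n(F)` (an open subgroup is closed). [cite: PlatonovRapinchuk1994, §3.3] -/
theorem isClosed_closure_isCompact (n : ℕ) :
    IsClosed (Subgroup.closure (⋃ K ∈ {K : Subgroup (GL (Fin n) F) | IsCompact (K : Set (GL (Fin n) F))}, (K : Set (GL (Fin n) F))) :
      Set (GL (Fin n) F)) :=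
  Subgroup.isClosed_of_isOpen _ (isOpen_closure_isCompact n)

/-- **Which one-slot diagonals lie in `⟨compact subgroups⟩`**: `diag(1, …, a, …, 1) ∈ ⟨compact subgroups⟩ ↔ v(a) = 1` — so the extra generators
`glDiagonal n F (update 1 i a)` of ★ p850404's `closure_isCompact_union_range_glDiagonal_update_eq_top` are redundant exactly when `a ∈ 𝒪_Fˣ`. [cite: BushnellHenniart2006, §7.2] [cite: PlatonovRapinchuk1994, §3.3] -/
theorem glDiagonal_update_mem_closure_isCompact_iff {n : ℕ} (i : Fin n) (a : Fˣ) :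
    glDiagonal n F (Function.update (1 : Fin n → Fˣ) i a) ∈
        Subgroup.closure (⋃ K ∈ {K : Subgroup (GL (Fin n) F) | IsCompact (K : Set (GL (Fin n) F))}, (K : Set (GL (Fin n) F))) ↔
      valuation F (a : F) = 1 := by
  rw [mem_closure_isCompact_iff_valuation_det_eq_one, coe_glDiagonal, Matrix.det_diagonal]
  have hprod : (∏ k, (Function.update (1 : Fin n → Fˣ) i a k : F)) = a := by
    rw [Finset.prod_eq_single i]
    · rw [Function.update_self]
    · intro k _ hk
      rw [Function.update_of_ne hk, Pi.one_apply, Units.val_one]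
    · intro h
      exact absurd (Finset.mem_univ i) h
  rw [hprod]

/-- **`⟨compact subgroups⟩` is a PROPER subgroup of `GL_n(F)` for `n ≥ 1`**: the valuation of a non-archimedean local field is nontrivial, so some `a ∈ Fˣ` has
`v(a) ≠ 1`, and then `diag(a, 1, …, 1) ∉ ⟨compact subgroups⟩` — the one-slot diagonals in ★ p850404's generating set cannot be dropped. [cite: Serre1980Trees, Ch. II §1.2] [cite: PlatonovRapinchuk1994, §3.3] -/
theorem closure_isCompact_ne_top (n : ℕ) :
    Subgroup.closure (⋃ K ∈ {K : Subgroup (GL (Fin (n + 1)) F) | IsCompact (K : Set (GL (Fin (n + 1)) F))}, (K : Set (GL (Fin (n + 1)) F))) ≠ ⊤ := by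
  obtain ⟨γ, hγ0, hγ1⟩ := ValuativeRel.IsNontrivial.condition (R := F)
  obtain ⟨x, hx⟩ := ValuativeRel.valuation_surjective γ
  have hx0 : x ≠ 0 := by
    rintro rfl
    exact hγ0 (by rw [← hx, map_zero])
  intro htop
  have hmem : glDiagonal (n + 1) F (Function.update (1 : Fin (n + 1) → Fˣ) 0 (Units.mk0 x hx0)) ∈
      Subgroup.closure (⋃ K ∈ {K : Subgroup (GL (Fin (n + 1)) F) | IsCompact (K : Set (GL (Fin (n + 1)) F))}, (K : Set (GL (Fin (n + 1)) F))) := by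
    rw [htop]
    exact Subgroup.mem_top _
  rw [glDiagonal_update_mem_closure_isCompact_iff, Units.val_mk0, hx] at hmem
  exact hγ1 hmem

end Literature.NumberTheory.LocalFields
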